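import Summits.BirchSwinnertonDyer.BirchSwinnertonDyer.Theses.TameQuarticSolvent
import Summits.BirchSwinnertonDyer.BirchSwinnertonDyer.Theses.TameQuarticManinParity
import Summits.BirchSwinnertonDyer.BirchSwinnertonDyer.Theses.KatoDescentTamePotSupersingular
import Summits.BirchSwinnertonDyer.BirchSwinnertonDyer.Theorems.TameQuarticSolventSolventPairLowerBoundTwistDatumOfFriedbergHoffstein
import HarnessLib

/-!
# Route `TameQuarticSolvent`, crux `SolventPairLowerBound` (stmt-BirchSwinnertonDyer-21391) —
# the crux BY NAME from the two `ℚ`-side LOWER halves at `3` (the degenerate line; cross-route domination)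

HONEST FRAMING. Theorems only; helper (`--supports stmt-BirchSwinnertonDyer-21391`), CONDITIONAL on every
displayed hypothesis; credits nothing toward closing the item; BSD is not proved by any of this. No new
definition, no new named fact, no restatement of the crux (the route decl is concluded BY NAME).

WHAT. The deciding crux `SolventPairLowerBound` asks, for `E` on the (t′) rank-one leaf at `3`, for an admissible
rank-zero twist `E_d` (`d > 0`, `v₃(d) = 1`, again (t′)) together with the PAIR inequality
`ord₃ Ш_an(E) + ord₃ Ш_an(E_d) ≤ ord₃ #Ш(E) + ord₃ #Ш(E_d)`. The twist exists by modularity + Friedberg–Hoffstein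
(`stub_twistDatum_of_friedbergHoffstein`, p579407), and the pair inequality is the SUM of the two `ℚ`-side lower
halves in the tree's typed currency `Typed.MissingLowerBoundAt · 3` — for `E` (rank one) and for `E_d` (rank zero).
Hence:
* `solventPairLowerBound_of_missingLowerBoundAt` — crux ⟸ modularity ∧ FH Thm B(1) at `3` ∧ (lower half at `3`
  on the (t′) rank-ONE rows) ∧ (lower half at `3` on the (t′) rank-ZERO rows);
* `solventPairLowerBound_of_tprimeRankOneLowerAtThree_of_tameLowerHalfRankZero` — the same BY NAME from the
  EXISTING items `TameQuarticManinParity.TprimeRankOneLowerAtThree` (stmt-BirchSwinnertonDyer-23739) and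
  `KatoDescentTamePotSupersingular.TameLowerHalfRankZero` (stmt-BirchSwinnertonDyer-19981, split; open core 19618);
* `solventPairLowerBound_of_tameRankOne_of_tameLowerHalfRankZero` — the same from route KT's residual
  `KatoDescentTamePotSupersingular.TameRankOne` (stmt-BirchSwinnertonDyer-19984) and `TameLowerHalfRankZero`
  (the route text's own «a proof of KT's residual TameRankOne 19984 at p = 3 elsewhere moots the route», in kernel
  form).

WHY (lead tqs-p1 g4's verdict, memo `Cruxes/SolventPairLowerBound/LEAD-g4-21391.md`): line `birth` replaces the
rank-one lower half over `ℚ` (23739) by the LOWER half of `BSD₃(E_M/M)` over a totally real quartic `M` at a place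
with `e(w∣3) = 4` (split child 23963, K1⁻) plus an Euler-system UPPER bound for the twisted constituent over
`ℚ(√d)` (23964/23965, K2a). Every number field over which a (t′) curve is good above `3` has `4 ∣ e(w∣3)` (tree:
`Summit.BirchSwinnertonDyer.Rank1Residual.Additive.semistabilityIndex_dvd_ramificationIdx_of_hasGoodReductionAt`,
`SubTprime` = `e_E(3) ∤ 2`), i.e. `e ≥ 4 > p = 3`: outside every signed / abelian-semistabilisation Iwasawa theory
in print (Kobayashi 2003: `ℚ_p`; B. D. Kim, JNT 183 (2018) = arXiv:1608.03315 §3: `e < p`, `ζ_p ∉ K′`;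
Lei–Loeffler–Zerbes Wach modules: unramified; Delbourgo 1998 Hyp. (G): `e_E ∣ p − 1`). So 23963 is not easier
than 23739 — it is the same «main-conjecture ⊇ at a supersingular `3`» question over a harder base — and these
theorems record that the crux already follows from 23739 and the (largely closed) rank-zero lower half 19981.

References: S. Friedberg, J. Hoffstein, Ann. of Math. 142 (1995) Thm. B(1); C. Breuil, B. Conrad, F. Diamond,
R. Taylor, J. Amer. Math. Soc. 14 (2001); R. L. Miller, LMS J. Comput. Math. 14 (2011) Def. 1.1.
-/

-- D-0017: single-problem summit, so `Summit.BirchSwinnertonDyer.BirchSwinnertonDyer.…` repeats a namespace BY DESIGN.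
set_option linter.dupNamespace false

noncomputable section

open WeierstrassCurve Literature.NumberTheory.EllipticCurves Literature.NumberTheory.EllipticCurves.ModularForms
  Literature.NumberTheory.EllipticCurves.Rank1Residual

namespace Summit.BirchSwinnertonDyer.BirchSwinnertonDyer.Theorems.SolventPairLowerBound

/-- **The crux from the two `ℚ`-side lower halves at `3`.** GIVEN modularity (`hmod`), Friedberg–Hoffstein
Thm. B(1) over `ℚ` with ramification prescribed at `3` (`hFH`), the lower half `ord₃ Ш_an ≤ ord₃ #Ш`
(`Typed.MissingLowerBoundAt · 3`) on the non-CM (t′) rank-ONE rows (`hL1`) and on the non-CM (t′) rank-ZERO rows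
(`hL0`), the route decl `SolventPairLowerBound` holds: take the admissible rank-zero twist of
`stub_twistDatum_of_friedbergHoffstein` and add the two inequalities. CONDITIONAL; credits nothing.
[cite: FriedbergHoffstein1995, Thm. B (1)] [cite: Miller2011LMS, Def. 1.1] -/
theorem solventPairLowerBound_of_missingLowerBoundAt (hmod : exists_isNewformOf)
    (hFH : friedbergHoffstein_exists_pos_twist_ne_zero_ramifiedAtThree)
    (hL1 : ∀ (W : WeierstrassCurve ℚ) [W.IsElliptic] [W.IsGloballyMinimal],
      ¬ W.HasCM → Addv W 3 → Summit.BirchSwinnertonDyer.Rank1Residual.Additive.SubTprime W 3 →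
        W.analyticRank = 1 → Typed.MissingLowerBoundAt W 3)
    (hL0 : ∀ (W : WeierstrassCurve ℚ) [W.IsElliptic] [W.IsGloballyMinimal],
      ¬ W.HasCM → Addv W 3 → Summit.BirchSwinnertonDyer.Rank1Residual.Additive.SubTprime W 3 →
        W.analyticRank = 0 → Typed.MissingLowerBoundAt W 3) :
    Summit.BirchSwinnertonDyer.BirchSwinnertonDyer.Theses.TameQuarticSolvent.SolventPairLowerBound := by
  intro W _ _ hCM hadd hsub hr
  obtain ⟨d, Wd, i1, i2, hd, hv, htw, hCMd, haddd, hsubd, hr0⟩ :=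
    stub_twistDatum_of_friedbergHoffstein hmod hFH W hCM hadd hsub hr
  obtain ⟨q, hq, hle⟩ := hL1 W hCM hadd hsub hr
  obtain ⟨q', hq', hle'⟩ := @hL0 Wd i1 i2 hCMd haddd hsubd hr0
  exact ⟨d, Wd, i1, i2, hd, hv, htw, hCMd, haddd, hsubd, hr0, q, q', hq, hq', add_le_add hle hle'⟩

/-- **Cross-route domination, BY NAME.** GIVEN modularity and Friedberg–Hoffstein Thm. B(1) at `3`, the items
`TameQuarticManinParity.TprimeRankOneLowerAtThree` (stmt-BirchSwinnertonDyer-23739: the lower half at `3` on the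
(t′) rank-one leaf) and `KatoDescentTamePotSupersingular.TameLowerHalfRankZero` (stmt-BirchSwinnertonDyer-19981:
the lower half at every odd additive tame (t′) prime in rank zero, here at `p = 3`) imply the deciding crux
`SolventPairLowerBound` of route `TameQuarticSolvent` (stmt-BirchSwinnertonDyer-21391). CONDITIONAL; credits
nothing; neither hypothesis item is proved here. [cite: FriedbergHoffstein1995, Thm. B (1)]
[cite: Miller2011LMS, Def. 1.1] -/
theorem solventPairLowerBound_of_tprimeRankOneLowerAtThree_of_tameLowerHalfRankZero
    (hmod : exists_isNewformOf) (hFH : friedbergHoffstein_exists_pos_twist_ne_zero_ramifiedAtThree)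
    (h1 : Summit.BirchSwinnertonDyer.BirchSwinnertonDyer.Theses.TameQuarticManinParity.TprimeRankOneLowerAtThree)
    (h0 : Summit.BirchSwinnertonDyer.BirchSwinnertonDyer.Theses.KatoDescentTamePotSupersingular.TameLowerHalfRankZero) :
    Summit.BirchSwinnertonDyer.BirchSwinnertonDyer.Theses.TameQuarticSolvent.SolventPairLowerBound :=
  haveI : Fact (Nat.Prime 3) := ⟨Nat.prime_three⟩
  solventPairLowerBound_of_missingLowerBoundAt hmod hFH h1
    (fun W _ _ _ hadd hsub hr0 => h0 W 3 hr0 (by norm_num) hadd hsub)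

/-- **The route's «superseded» clause in kernel form.** GIVEN modularity and Friedberg–Hoffstein Thm. B(1) at `3`,
route KT's residual `KatoDescentTamePotSupersingular.TameRankOne` (stmt-BirchSwinnertonDyer-19984: the full missing
`p`-part at every odd additive tame (t′) prime in analytic rank one; only its LOWER half at `p = 3` is used) and
`TameLowerHalfRankZero` (stmt-BirchSwinnertonDyer-19981) imply `SolventPairLowerBound`. CONDITIONAL; credits
nothing. [cite: Miller2011LMS, Def. 1.1] [cite: FriedbergHoffstein1995, Thm. B (1)] -/
theorem solventPairLowerBound_of_tameRankOne_of_tameLowerHalfRankZero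
    (hmod : exists_isNewformOf) (hFH : friedbergHoffstein_exists_pos_twist_ne_zero_ramifiedAtThree)
    (h1 : Summit.BirchSwinnertonDyer.BirchSwinnertonDyer.Theses.KatoDescentTamePotSupersingular.TameRankOne)
    (h0 : Summit.BirchSwinnertonDyer.BirchSwinnertonDyer.Theses.KatoDescentTamePotSupersingular.TameLowerHalfRankZero) :
    Summit.BirchSwinnertonDyer.BirchSwinnertonDyer.Theses.TameQuarticSolvent.SolventPairLowerBound :=
  haveI : Fact (Nat.Prime 3) := ⟨Nat.prime_three⟩
  solventPairLowerBound_of_missingLowerBoundAt hmod hFH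
    (fun W _ _ _ hadd hsub hr =>
      (Typed.lower_and_upper_of_missingPPartAt W 3 (h1 W 3 hr (by norm_num) hadd hsub)).1)
    (fun W _ _ _ hadd hsub hr0 => h0 W 3 hr0 (by norm_num) hadd hsub)

/-- **Converse domination, BY NAME.** The deciding crux `SolventPairLowerBound` of route `TameQuarticSolvent`
(stmt-BirchSwinnertonDyer-21391) together with the route's rank-zero Kato-side crux `TprimeRankZeroUpperAtThree`
(stmt-BirchSwinnertonDyer-21393: `ord₃ #Ш ≤ ord₃ Ш_an` on the non-CM (t′) rank-ZERO rows) implies the item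
`TameQuarticManinParity.TprimeRankOneLowerAtThree` (stmt-BirchSwinnertonDyer-23739, the rank-one LOWER half at `3`
over `ℚ`): for `E` on the leaf take the pair `(d, E_d, q, q′)` of the crux; the upper half for `E_d` gives
`ord₃ #Ш(E_d) ≤ ord₃ q′` (the rational value of `Ш_an(E_d)` is unique), whence `ord₃ q ≤ ord₃ #Ш(E)`. Together with
`solventPairLowerBound_of_tprimeRankOneLowerAtThree_of_tameLowerHalfRankZero` above this records in the kernel that
21391 and 23739 are EQUIVALENT modulo the two rank-zero halves at `3` on the (t′) rows (lower: KT 19981; upper: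
21393) and the two print inputs (modularity, Friedberg–Hoffstein at `3`): the pair crux is exactly as hard as the
rank-one lower half over `ℚ`, no easier and no harder. It is the first step of the route's certified `closes`,
exposed by name for route `TameQuarticManinParity`. CONDITIONAL; credits nothing; proves neither item; BSD is not
proved by any of this. [cite: Miller2011LMS, Def. 1.1] -/
theorem tprimeRankOneLowerAtThree_of_solventPairLowerBound_of_tprimeRankZeroUpperAtThree
    (hA : Summit.BirchSwinnertonDyer.BirchSwinnertonDyer.Theses.TameQuarticSolvent.SolventPairLowerBound)
    (hC : Summit.BirchSwinnertonDyer.BirchSwinnertonDyer.Theses.TameQuarticSolvent.TprimeRankZeroUpperAtThree) :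
    Summit.BirchSwinnertonDyer.BirchSwinnertonDyer.Theses.TameQuarticManinParity.TprimeRankOneLowerAtThree := by
  intro W _ _ hCM hadd hsub hr
  obtain ⟨d, Wd, _, _, -, -, -, hCMd, haddd, hsubd, hr0, q, q', hq, hq', hle⟩ := hA W hCM hadd hsub hr
  obtain ⟨q'', hq'', hge⟩ := hC Wd hCMd haddd hsubd hr0
  have hqq : q'' = q' := by exact_mod_cast hq''.symm.trans hq'
  subst hqq
  exact ⟨q, hq, by linarith⟩

end Summit.BirchSwinnertonDyer.BirchSwinnertonDyer.Theorems.SolventPairLowerBound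

end
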